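import Literature.MathematicalPhysics.QuantumLattice.PairedProductStates
import Literature.MathematicalPhysics.QuantumLattice.HubbardPairDensityCouplingFloor
import Literature.MathematicalPhysics.QuantumLattice.FinDimSpectrumSectorGibbsLimit
import Summits.HubbardSuperconductivity.HubbardSuperconductivity.Theorems.SoloBlindSpinPolarization
import HarnessLib

/-!
# The Nagaoka witness: a zero-order vector of the summit's sector caps its floor uniformly in `U`

Solo-blind residency `solo-HubbardSuperconductivity-blind`, generation 30, Theorem 35 (part 1 of 2).

For a duplicate-free list `l` of `2n` lattice momenta let `Π_l = Π_{k∈l} c†_{k↑}|0⟩` be the spin-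
polarised plane-wave Slater determinant (written out as `(l.map fun k => momentumCreation k 0).prod
*ᵥ vacuum` below) and `Ψ_l = (S⁻)^n Π_l` its `S^z = 0` descendant — the member of the saturated
("Nagaoka") spin multiplet that lives in the summit's sector `szSector (2n) 0`. For EVERY real `U`:

* `hubbardTorus_mulVec_polarized` — `H_U Π_l = (Σ_{k∈l} ε_L(k)) Π_l` (`L ≥ 3`): a polarised Slater
  determinant never sees the on-site repulsion (`interaction_mulVec_eq_zero_of_isInSector`);
* `exists_nagaoka_witness` — `Ψ_l ∈ szSector (2n) 0`, `Ψ_l ≠ 0`, `⟨Ψ_l, H_U Ψ_l⟩ = (Σ_{k∈l} ε_L(k))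
  ⟨Ψ_l, Ψ_l⟩` (SU(2) ladder, `[H_U, S^±] = 0`) and `Δ_g Ψ_l = 0` for EVERY form factor `g`: the
  singlet pair field is blind to the saturated multiplet (Theorem 14(b),
  `re_expect_pairField_ladder_le`, with minority population `0`);
* `minEnergyOn_crutch_le_polarizedSum` — **Theorem 35**: consequently, for every real `U`, `c` and
  every `g`, `minEnergyOn (H_U + c·Δ_gᴴΔ_g) (szSector (2n) 0) ≤ Σ_{k∈l} ε_L(k)`: the sector floor
  of the Hubbard Hamiltonian AND of every pair-crutched Hamiltonian is capped, uniformly in `U` and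
  in the crutch strength, by the free energy of `2n` polarised electrons — a state with ZERO pair
  order (`minEnergyOn_le_polarizedSum` is the case `c = 0`).

Part 2 (`SoloBlindNagaokaCeiling`) chooses `l` = the complement of a hole pocket at the zone corner
and turns this into the explicit cap `-(8L²/π²) sin²(Kπ/L) + 4·(δL² - |pocket|)`, i.e.
`≈ -4δL² + (2π²/3)δ²L²`: the Mott floor of Theorem 34 is sharp to `O(δ² + 1/U)` uniformly in `U`,
and the dimer-condensate method of Theorems 33′/34 cannot certify order below `g ≈ 8` however the
floor is improved (obstruction report §5.20(10)).

Elementary (momentum-space CAR, the SU(2) ladder of Theorem 14); no sorry; no new definitions (the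
`S^z = 0` rung is never spelled out: its four properties are collected from the ladder lemmas, which
keeps the file on one `DecidableEq` instance path). Nagaoka, Phys. Rev. 147 (1966) 392 and Tasaki,
Prog. Theor. Phys. 99 (1998) 489 for the saturated multiplet (context only; no theorem of theirs is
used). [folklore] for the CAR bookkeeping, [this work] for the assembly.
-/

noncomputable section

namespace Summit.HubbardSuperconductivity.HubbardSuperconductivity.Theorems.NagaokaWitness

open Matrix Finset Literature.MathematicalPhysics.QuantumLattice HubbardWave0
  Literature.Probability.LatticeModels
open Literature.MathematicalPhysics.QuantumLattice.LiebThm1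
open Summit.HubbardSuperconductivity.HubbardSuperconductivity.Theorems.SpinPolarization
open scoped ComplexOrder

variable {L : ℕ} [NeZero L]

/-! ### The polarised plane-wave product `Π_l = (l.map fun k => c†_{k↑}).prod |0⟩` -/

/-- Unfolding along `k :: l`: `Π_{k :: l} = c†_{k↑} Π_l`. [folklore] -/
theorem polarized_cons (k : TorusSite 2 L) (l : List (TorusSite 2 L)) :
    ((k :: l).map fun q => momentumCreation q 0).prod *ᵥ (vacuum : Fock (Orb (FermionTorus 2 L))) =
      momentumCreation k 0 *ᵥ ((l.map fun q => momentumCreation q 0).prod *ᵥ vacuum) := by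
  simp only [List.map_cons, List.prod_cons, mulVec_mulVec]

omit [NeZero L] in
/-- The vacuum lies in the sector `(0, 0)`. [folklore] -/
private theorem isInSector_vacuum : IsInSector 0 0 (vacuum : Fock (Orb (FermionTorus 2 L))) := by
  intro s hs
  have hs' : s ≠ ∅ := by
    rintro rfl
    exact hs ⟨by simp [upPart], by simp [downPart]⟩
  simp [vacuum, hs']

/-- `c†_{k↑}` maps the sector `(a, b)` to `(a + 1, b)` (it is a combination of the `c†_{x↑}`).
[folklore] -/
theorem isInSector_momentumCreation_up_mulVec {a b : ℕ} {ψ : Fock (Orb (FermionTorus 2 L))}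
    (hψ : IsInSector a b ψ) (k : TorusSite 2 L) :
    IsInSector (a + 1) b (momentumCreation k 0 *ᵥ ψ) := by
  rw [momentumCreation_eq_sum, sum_mulVec]
  refine Finset.sum_induction _ (fun φ => IsInSector (a + 1) b φ) (fun _ _ hu hv => hu.add hv)
    (IsInSector.zero _ _) fun x _ => ?_
  rw [Matrix.smul_mulVec]
  exact (hψ.creation_up_mulVec x).smul _

/-- `Π_l` lies in the fully polarised sector `(|l|, 0)`. [folklore] -/
theorem isInSector_polarized (l : List (TorusSite 2 L)) :
    IsInSector l.length 0
      ((l.map fun q => momentumCreation q 0).prod *ᵥ (vacuum : Fock (Orb (FermionTorus 2 L)))) := by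
  induction l with
  | nil =>
    simpa only [List.map_nil, List.prod_nil, one_mulVec, List.length_nil] using isInSector_vacuum
  | cons k l ih =>
    rw [polarized_cons, List.length_cons]
    exact isInSector_momentumCreation_up_mulVec ih k

/-- `n_{qσ} |0⟩ = 0`. [folklore] -/
theorem momentumNumber_mulVec_vacuum (q : TorusSite 2 L) (σ : Fin 2) :
    momentumNumber q σ *ᵥ (vacuum : Fock (Orb (FermionTorus 2 L))) = 0 := by
  rw [momentumNumber, ← mulVec_mulVec, momentumAnnihilation_mulVec_vacuum, mulVec_zero]

/-- `n_{q↑} Π_l = Π_l` for `q ∈ l`. [folklore] -/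
theorem momentumNumber_up_polarized_of_mem {l : List (TorusSite 2 L)} {q : TorusSite 2 L}
    (hq : q ∈ l) :
    momentumNumber q 0 *ᵥ ((l.map fun q => momentumCreation q 0).prod *ᵥ
        (vacuum : Fock (Orb (FermionTorus 2 L)))) =
      (l.map fun q => momentumCreation q 0).prod *ᵥ vacuum := by
  induction l with
  | nil => simp at hq
  | cons k l ih =>
    rw [polarized_cons, mulVec_mulVec]
    by_cases hqk : q = k
    · subst hqk
      rw [momentumNumber_mul_momentumCreation_self]
    · have hql : q ∈ l := (List.mem_cons.1 hq).resolve_left hqk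
      rw [momentumNumber_mul_momentumCreation_of_ne (fun h => hqk h.1), ← mulVec_mulVec, ih hql]

/-- `n_{q↑} Π_l = 0` for `q ∉ l`. [folklore] -/
theorem momentumNumber_up_polarized_of_not_mem {l : List (TorusSite 2 L)} {q : TorusSite 2 L}
    (hq : q ∉ l) :
    momentumNumber q 0 *ᵥ ((l.map fun q => momentumCreation q 0).prod *ᵥ
        (vacuum : Fock (Orb (FermionTorus 2 L)))) = 0 := by
  induction l with
  | nil => rw [List.map_nil, List.prod_nil, one_mulVec, momentumNumber_mulVec_vacuum]
  | cons k l ih =>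
    have hqk : q ≠ k := fun h => hq (h ▸ List.mem_cons_self)
    have hql : q ∉ l := fun h => hq (List.mem_cons_of_mem _ h)
    rw [polarized_cons, mulVec_mulVec, momentumNumber_mul_momentumCreation_of_ne (fun h => hqk h.1),
      ← mulVec_mulVec, ih hql, mulVec_zero]

/-- `n_{q↓} Π_l = 0`: no down electrons. [folklore] -/
theorem momentumNumber_down_polarized (l : List (TorusSite 2 L)) (q : TorusSite 2 L) :
    momentumNumber q 1 *ᵥ ((l.map fun q => momentumCreation q 0).prod *ᵥ
        (vacuum : Fock (Orb (FermionTorus 2 L)))) = 0 := by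
  induction l with
  | nil => rw [List.map_nil, List.prod_nil, one_mulVec, momentumNumber_mulVec_vacuum]
  | cons k l ih =>
    rw [polarized_cons, mulVec_mulVec,
      momentumNumber_mul_momentumCreation_of_ne (fun h => absurd h.2 (by decide)), ← mulVec_mulVec,
      ih, mulVec_zero]

/-- **Normalisation**: `⟨Π_l, Π_l⟩ = 1` for a duplicate-free `l` (`c_k c†_k = 1 - n_k`).
[folklore] -/
theorem star_polarized_dotProduct_self {l : List (TorusSite 2 L)} (hl : l.Nodup) :
    star ((l.map fun q => momentumCreation q 0).prod *ᵥ (vacuum : Fock (Orb (FermionTorus 2 L)))) ⬝ᵥ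
      ((l.map fun q => momentumCreation q 0).prod *ᵥ vacuum) = 1 := by
  induction l with
  | nil => rw [List.map_nil, List.prod_nil, one_mulVec, star_vacuum_dotProduct_vacuum]
  | cons k l ih =>
    obtain ⟨hk, hl'⟩ := List.nodup_cons.1 hl
    have hn : momentumCreation k 0 * momentumAnnihilation k 0 = momentumNumber k (0 : Fin 2) := rfl
    rw [polarized_cons, star_mulVec, ← dotProduct_mulVec, momentumCreation_conjTranspose,
      mulVec_mulVec, momentumAnnihilation_mul_momentumCreation, if_pos ⟨rfl, rfl⟩, sub_mulVec,
      one_mulVec, hn, momentumNumber_up_polarized_of_not_mem hk, sub_zero, ih hl']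

/-- `Π_l ≠ 0` for a duplicate-free `l`. [folklore] -/
theorem polarized_ne_zero {l : List (TorusSite 2 L)} (hl : l.Nodup) :
    (l.map fun q => momentumCreation q 0).prod *ᵥ (vacuum : Fock (Orb (FermionTorus 2 L))) ≠ 0 := by
  intro h
  have h1 := star_polarized_dotProduct_self hl
  rw [h, dotProduct_zero] at h1
  exact zero_ne_one h1

/-! ### Polarised vectors see neither `S⁺` nor the repulsion -/

omit [NeZero L] in
/-- `S⁺ ψ = 0` on the sectors without down electrons. [folklore] -/
theorem spinPlus_mulVec_eq_zero_of_isInSector {a : ℕ} {ψ : Fock (Orb (FermionTorus 2 L))}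
    (hψ : IsInSector a 0 ψ) : spinPlus *ᵥ ψ = 0 := by
  rw [spinPlus, sum_mulVec]
  refine Finset.sum_eq_zero fun x _ => ?_
  rw [← mulVec_mulVec, hψ.annihilation_down_mulVec_eq_zero x, mulVec_zero]

omit [NeZero L] in
/-- `Σ_x n_{x↑}n_{x↓} ψ = 0` on the sectors without down electrons. [folklore] -/
theorem interaction_mulVec_eq_zero_of_isInSector {a : ℕ} {ψ : Fock (Orb (FermionTorus 2 L))}
    (hψ : IsInSector a 0 ψ) :
    (∑ x : FermionTorus 2 L, numberOp x 0 * numberOp x 1) *ᵥ ψ = 0 := by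
  rw [sum_mulVec]
  refine Finset.sum_eq_zero fun x _ => ?_
  funext s
  rw [LiebTwo.numberOp_mul_numberOp_mulVec, Pi.zero_apply]
  split_ifs with h
  · refine hψ s fun hc => ?_
    have hx : x ∈ downPart s := by rw [mem_downPart]; exact h.2
    rw [card_eq_zero.1 hc.2] at hx
    exact notMem_empty _ hx
  · rfl

/-! ### `Π_l` is a `U`-independent eigenvector; its `S^z = 0` rung is the witness -/

/-- **`H_U Π_l = (Σ_{k∈l} ε_L(k)) Π_l` for every real `U`** (`L ≥ 3`): the polarised plane-wave
product is a free eigenvector and carries no double occupancy. [folklore] -/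
theorem hubbardTorus_mulVec_polarized (hL : 3 ≤ L) (U : ℝ) (l : List (TorusSite 2 L)) :
    hubbardTorus 2 L 1 U *ᵥ ((l.map fun q => momentumCreation q 0).prod *ᵥ
        (vacuum : Fock (Orb (FermionTorus 2 L)))) =
      ((∑ k ∈ l.toFinset, torusBand L k : ℝ) : ℂ) • ((l.map fun q => momentumCreation q 0).prod *ᵥ
        (vacuum : Fock (Orb (FermionTorus 2 L)))) := by
  rw [hubbardTorus_eq_zero_add_smul_interaction U, add_mulVec, Matrix.smul_mulVec,
    interaction_mulVec_eq_zero_of_isInSector (isInSector_polarized l), smul_zero, add_zero,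
    hubbardTorus_zero_eq_sum_momentumNumber hL, sum_mulVec]
  have hterm : ∀ k : TorusSite 2 L,
      (∑ σ : Fin 2, ((torusBand L k : ℝ) : ℂ) • momentumNumber k σ) *ᵥ
          ((l.map fun q => momentumCreation q 0).prod *ᵥ (vacuum : Fock (Orb (FermionTorus 2 L)))) =
        (if k ∈ l.toFinset then ((torusBand L k : ℝ) : ℂ) else 0) •
          ((l.map fun q => momentumCreation q 0).prod *ᵥ
            (vacuum : Fock (Orb (FermionTorus 2 L)))) := by
    intro k
    rw [Fin.sum_univ_two, add_mulVec, Matrix.smul_mulVec, Matrix.smul_mulVec,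
      momentumNumber_down_polarized, smul_zero, add_zero]
    split_ifs with hk
    · rw [momentumNumber_up_polarized_of_mem (List.mem_toFinset.1 hk)]
    · rw [momentumNumber_up_polarized_of_not_mem (fun h => hk (List.mem_toFinset.2 h)), smul_zero,
        zero_smul]
  simp_rw [hterm]
  rw [← Finset.sum_smul, ← Finset.sum_filter]
  congr 1
  rw [Finset.filter_mem_eq_inter, Finset.univ_inter]
  push_cast
  rfl

omit [NeZero L] in
/-- `re ⟨Ψ, AᴴA Ψ⟩ ≤ 0` forces `A Ψ = 0` (`AᴴA ≥ 0`). [folklore] -/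
private theorem mulVec_eq_zero_of_re_le_zero
    {A : Matrix (Finset (Orb (FermionTorus 2 L))) (Finset (Orb (FermionTorus 2 L))) ℂ}
    {Ψ : Fock (Orb (FermionTorus 2 L))} (h : (star Ψ ⬝ᵥ (Aᴴ * A) *ᵥ Ψ).re ≤ 0) : A *ᵥ Ψ = 0 := by
  rw [← mulVec_mulVec, ← ThermodynamicLimit.star_mulVec_dotProduct] at h
  have hnn := dotProduct_star_self_nonneg (A *ᵥ Ψ)
  exact (star_dotProduct_self_eq_zero_iff _).1
    (Complex.ext (le_antisymm h (Complex.nonneg_iff.1 hnn).1) ((Complex.nonneg_iff.1 hnn).2).symm)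

/-- **The Nagaoka witness.** For `L ≥ 3`, every real `U` and every duplicate-free list `l` of `2n`
momenta there is a vector `Ψ` (namely `(S⁻)^n Π_l`) with: `Ψ ∈ szSector (2n) 0`, `⟨Ψ, Ψ⟩ > 0`,
`⟨Ψ, H_U Ψ⟩ = (Σ_{k∈l} ε_L(k)) ⟨Ψ, Ψ⟩`, and `Δ_g Ψ = 0` for every form factor `g` — a member of
the summit's sector with the free polarised energy and NO singlet pair field at all. [this work] -/
theorem exists_nagaoka_witness (hL : 3 ≤ L) (U : ℝ) {l : List (TorusSite 2 L)} (hl : l.Nodup)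
    (n : ℕ) (hln : l.length = 2 * n) :
    ∃ Ψ ∈ szSector (Λ := FermionTorus 2 L) (2 * n) 0, 0 < star Ψ ⬝ᵥ Ψ ∧
      star Ψ ⬝ᵥ (hubbardTorus 2 L 1 U *ᵥ Ψ) =
        ((∑ k ∈ l.toFinset, torusBand L k : ℝ) : ℂ) * (star Ψ ⬝ᵥ Ψ) ∧
      ∀ g : Site 2 → ℝ, pairField g L *ᵥ Ψ = 0 := by
  -- the highest-weight vector `Π_l`
  have hP := isInSector_polarized l
  have hhw := spinPlus_mulVec_eq_zero_of_isInSector hP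
  have h0 := polarized_ne_zero hl
  have hP1 := star_polarized_dotProduct_self hl
  have hHP := hubbardTorus_mulVec_polarized hL U l
  -- its `n`-th rung `Ψ = (S⁻)^n Π_l`: sector, norm, energy, pair field
  have hsec := isInSector_spinMinus_pow_mulVec hP n (by omega)
  rw [hln, show 2 * n - n = n by omega, zero_add] at hsec
  have hmem := (mem_szSector_iff_isInSector n n _).2 hsec
  rw [show ((n : ℝ) - n) / 2 = 0 by ring, ← two_mul] at hmem
  have hpos := ladder_norm_pos hP hhw h0 n (by rw [hln]; omega)
  have hcomm : Commute spinPlus (hubbardTorus 2 L 1 U) :=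
    (hamiltonian_commute_spinPlus (fermionTorusGraph 2 L) 1 U).symm
  have hexp := ladder_expect_mul_norm hP hhw hcomm n (by omega)
  rw [hP1, mul_one, hHP, dotProduct_smul, hP1, smul_eq_mul, mul_one] at hexp
  refine ⟨_, hmem, hpos, hexp, fun g => ?_⟩
  have hle := re_expect_pairField_ladder_le g hP hhw h0 n (by rw [hln]; omega)
  simp only [Nat.cast_zero, mul_zero, zero_mul] at hle
  exact mulVec_eq_zero_of_re_le_zero hle

/-! ### The floor cap -/

/-- **Theorem 35 (the Nagaoka cap on the sector floor, uniform in `U` and in the crutch).** For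
`L ≥ 3`, every real `U` and `c`, every form factor `g`, and every duplicate-free list `l` of `2n`
momenta: `minEnergyOn (H_U + c·Δ_gᴴΔ_g) (szSector (2n) 0) ≤ Σ_{k∈l} ε_L(k)` — attained in Rayleigh
quotient by the zero-pair-order vector of `exists_nagaoka_witness`. [this work] -/
theorem minEnergyOn_crutch_le_polarizedSum (hL : 3 ≤ L) (U c : ℝ) (g : Site 2 → ℝ)
    {l : List (TorusSite 2 L)} (hl : l.Nodup) (n : ℕ) (hln : l.length = 2 * n) :
    (hubbardTorus 2 L 1 U + (c : ℂ) • ((pairField g L)ᴴ * pairField g L)).minEnergyOn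
        (szSector (Λ := FermionTorus 2 L) (2 * n) 0) ≤ ∑ k ∈ l.toFinset, torusBand L k := by
  obtain ⟨ψ, hψK, hψpos, hψH, hψΔ⟩ := exists_nagaoka_witness hL U hl n hln
  set E : ℝ := ∑ k ∈ l.toFinset, torusBand L k with hE
  set M := hubbardTorus 2 L 1 U + (c : ℂ) • ((pairField g L)ᴴ * pairField g L) with hM
  -- the quadratic form of the crutched Hamiltonian on the ray of `ψ`
  have hquad : star ψ ⬝ᵥ (M *ᵥ ψ) = (E : ℂ) * (star ψ ⬝ᵥ ψ) := by
    rw [hM, add_mulVec, Matrix.smul_mulVec, ← mulVec_mulVec, hψΔ g, mulVec_zero, smul_zero,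
      add_zero, hψH]
  have hscale : ∀ a : ℂ, star (a • ψ) ⬝ᵥ (M *ᵥ (a • ψ)) = (E : ℂ) * (star (a • ψ) ⬝ᵥ (a • ψ)) := by
    intro a
    rw [mulVec_smul, star_smul, smul_dotProduct, smul_dotProduct, dotProduct_smul, dotProduct_smul,
      hquad, smul_eq_mul, smul_eq_mul, smul_eq_mul, smul_eq_mul]
    ring
  -- normalise
  have hposre : 0 < (star ψ ⬝ᵥ ψ).re := (Complex.pos_iff.1 hψpos).1
  have hreal : star ψ ⬝ᵥ ψ = ((star ψ ⬝ᵥ ψ).re : ℂ) :=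
    ThermodynamicLimit.star_dotProduct_self_eq_re ψ
  set r : ℝ := Real.sqrt (star ψ ⬝ᵥ ψ).re with hr
  have hr2 : r ^ 2 = (star ψ ⬝ᵥ ψ).re := Real.sq_sqrt hposre.le
  set φ := ((r⁻¹ : ℝ) : ℂ) • ψ with hφ
  have hφ1 : star φ ⬝ᵥ φ = 1 := by
    have hr0 : (r : ℂ) ≠ 0 := by exact_mod_cast (Real.sqrt_pos.2 hposre).ne'
    rw [hφ, star_smul, smul_dotProduct, dotProduct_smul, smul_smul, hreal, Complex.star_def,
      Complex.conj_ofReal, smul_eq_mul, ← hr2]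
    push_cast
    field_simp
  have hHerm : M.IsHermitian := by
    refine (hamiltonian_isHermitian (fermionTorusGraph 2 L) 1 U).add ?_
    rw [IsHermitian, conjTranspose_smul, (isHermitian_conjTranspose_mul_self (pairField g L)).eq,
      Complex.star_def, Complex.conj_ofReal]
  have h := minEnergyOn_le_rayleigh_of_mem hHerm _ (Submodule.smul_mem _ _ hψK) hφ1
  have hray : star φ ⬝ᵥ (M *ᵥ φ) = (E : ℂ) := by
    have := hscale ((r⁻¹ : ℝ) : ℂ)
    rw [← hφ] at this
    rw [this, hφ1, mul_one]
  rw [hray, Complex.ofReal_re] at h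
  exact h

/-- **Corollary (the Hubbard floor itself).** For `L ≥ 3`, every real `U` and every duplicate-free
list `l` of `2n` momenta: `minEnergyOn H_U (szSector (2n) 0) ≤ Σ_{k∈l} ε_L(k)`. [this work] -/
theorem minEnergyOn_le_polarizedSum (hL : 3 ≤ L) (U : ℝ) {l : List (TorusSite 2 L)} (hl : l.Nodup)
    (n : ℕ) (hln : l.length = 2 * n) :
    (hubbardTorus 2 L 1 U).minEnergyOn (szSector (Λ := FermionTorus 2 L) (2 * n) 0) ≤
      ∑ k ∈ l.toFinset, torusBand L k := by
  have h := minEnergyOn_crutch_le_polarizedSum hL U 0 dWaveFormFactor hl n hln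
  rwa [Complex.ofReal_zero, zero_smul, add_zero] at h

end Summit.HubbardSuperconductivity.HubbardSuperconductivity.Theorems.NagaokaWitness
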